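import Summits.QuantumFields.YangMills.Theorems.BalabanUVNodesN15KingModelCovariantBlockOperator
import HarnessLib

/-!
# BalabanUVNodes ∕ N15 — THE KING-MODEL RUNG (PART Ϥ-e): ★★★ UNIFORM POSITIVITY OF THE FULL PROPAGATOR AT EVERY LINK FIELD BY THE TREE (AXIAL) GAUGE —
# `Re⟨v, A₀(U)v⟩ ≥ (m² + min(a, c∕(L^{d+1}·D)))·Σ_x‖v_x‖²` for EVERY unitary `U` (any fibre, abelian or not, NO regularity assumed) and every tree contour system of depth `≤ D`
# (comb: `D = (d+1)(L−1)`); hence the MASSLESS full propagator `G(U) = (−cΔ_U + aQ(U)^*Q(U))⁻¹` EXISTS AT EVERY `U` with the `U`-UNIFORM bound `‖G(U)‖ ≤ min(a, c∕(L^{d+1}D))⁻¹`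
# (Track A, DAG node N15 = NE2; FAN-OUT v1.1 §N15 s3 «KING-MODEL RUNG … + what the curved case adds»; count-neutral)

HONEST FRAMING.  Count-neutral (cell `pub-ymgap`, seat `pub-ymgap-dag-n15-e` g49; `--supports stmt-QuantumFields-27247 --as helper` = K3ᴬ, KEY MAP v3).  King's comparison model:
[Balaban1985BackgroundPropagators] p.395 l.1–3 asserts «Assuming some regularity of the configuration U it can be easily shown that the operator Δ′_a is positive.  This implies
positivity of the operators G′, Q′G′²Q′^*, hence the existence of the operator R»; here the positivity of the one-level operator `A₀(U)` (PART Ϥ-d) is PROVED for EVERY unitary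
`U`, with an explicit floor that is uniform in `U` and in the volume but POLYNOMIALLY SMALL in the block side `L` (`≍ c·L^{−(d+2)}`): PART Ϥ-f shows this order is ATTAINED at a
rough field, and PARTS Ϥ-g∕Ϥ-h give the `L`-uniform (η-uniform) floors at pure gauges and in small-field gauges, where Bałaban's regularity enters.  NOT Bałaban's multi-level
`G_k(U)`; NOT (3.42); NOT a node discharge (N15 of record untouched); nothing continuum ∕ ℝ⁴ ∕ OS ∕ Clay.

THE PROOF (tree gauge).  By Ϥ-d's form identity `Re⟨v,A₀(U)v⟩ = m²Σ‖v_x‖² + cΣ_{bonds}‖v_x − U(x,μ)v_{x+e_μ}‖² + aL^{d+1}Σ_y‖(Q(U)v)(y)‖²`.  Drop the bonds that are not contour bonds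
(each `≥ 0`; the contour bonds `(site y (parent j), axis j)` are distinct, Ϥ-b `treeBond_injective`).  In block `y` transport the field to the corner, `w_y(j) = U(Γ_{y,x_j})v(x_j)`
(Ϥ-c `blockTransport`): then ★ `‖v_{x⁻} − U(x⁻,μ)v_{x_j}‖ = ‖w_y(parent j) − w_y(j)‖` EXACTLY for the contour bond into `x_j` (`U(Γ_{y,x_j}) = U(Γ_{y,x⁻})U(x⁻,μ)` and `U(Γ_{y,x⁻})` is an
isometry) — the contour bonds are FLAT in the tree gauge —, `(Q(U)v)(y) = w̄_y` (Ϥ-c `fib_covQ_mulVec`) and `Σ_j‖w_y(j)‖² = Σ_{x∈B(y)}‖v_x‖²`.  PART Ϥ-a's `tree_coercive` on each block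
and the sum over blocks give the floor `min(a, c∕(L^{d+1}D))` — for EVERY `U`: no curvature, holonomy or smallness condition is used, only unitarity.
RESULTS: §1 ★★ `bondE_treeBond_eq` (tree-gauge flatness of the contour bonds), ★ `sum_treeBond_bondE_le` (contour bonds ≤ all bonds); §2 def `treeGap a c L d D = min a (c∕(L^{d+1}D))`, ★★★
**`re_quadForm_fullOpU_ge_tree`** (every tree contour system of depth `≤ D`, every unitary `U`), ★★★ **`re_quadForm_fullOpU_kingComb_ge`** (the comb, `D = (d+1)(L−1)`); §3 `treeGap_pos`, ★★
`eigenvalues_fullOpU_ge_tree`, ★★★ **`posDef_fullOpU_massless`** (`m² = 0`, `a, c > 0`, `D > 0`: THE MASSLESS FULL OPERATOR IS POSITIVE DEFINITE AT EVERY UNITARY `U` — contrast Ͱ-f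
`not_posDef_covLapF_massless_free`: without the block term the massless fine operator is singular already at `U ≡ 1`), `isUnit_fullOpU_massless`, ★★★ **`l2_opNorm_fullOpU_massless_inv_le`**
(`‖G(U)‖ ≤ (treeGap)⁻¹`, the same constant for every `U` and every volume), ★★ `king_full_propagator_uniform_in_U` (∃ one `γ > 0` for all unitary `U` at once).
PRIOR TREE ART (by name): Ϥ-a (`tree_coercive`, `treeMean`), Ϥ-b (`BlockTree`, `kingComb`, `kingComb_depth_le`, `treeHol_of_ne_root`, `treeHol_mem_unitaryGroup`, `site_eq_parent_add_unitVec`,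
`treeBond_injective`), Ϥ-c (`blockTransport`, `fib_covQ_mulVec`, `norm_blockTransport`, `sum_norm_blockTransport_sq`), Ϥ-d (`fullOpU`, `isHermitian_fullOpU`, `re_quadForm_fullOpU`), Ϳ-b (`bondE`,
`toEuclideanLin_mul_apply`), Ϡ-i (`eigenvalues_ge_of_coercive'`, `posDef_of_coercive'`, `l2_opNorm_inv_le_of_coercive'`), Ͱ-b (`norm_toEuclideanLin_of_mem_unitaryGroup`).  Dedup (rg at filing):
basename 0 files; needles `treeGap|bondE_treeBond_eq|re_quadForm_fullOpU_ge_tree|posDef_fullOpU_massless` 0 files in `Summits/QuantumFields/YangMills` + `Literature/MathematicalPhysics`.  presearch: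
«uniform positivity covariant Laplacian block averaging axial gauge tree» — corpus∕galaxy: the axial-gauge device is [Balaban1984PropagatorsI] (1.7) ∕ [Federbush1987PhaseCellIII] §5.3
(`CombGaugeObservation`), the positivity claim is [B9] p.395 l.1–3 (no proof printed); no printed `U`-uniform constant found.  Locators as cited.  0 `sorry`, 1 `def` (`treeGap`, a real constant).
-/

noncomputable section
open scoped BigOperators ComplexConjugate ComplexOrder Matrix.Norms.L2Operator
open Finset Matrix WithLp

namespace Summit.QuantumFields.YangMills.BalabanUVNodes.N15KingModelRung.CovariantBlock

open Literature.MathematicalPhysics.QuantumFieldTheory.Balaban1983to89.B5Prop11Plancherel (Tor fine unitVec)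
open Literature.MathematicalPhysics.QuantumFieldTheory.King1986.Torus (site)
open Summit.QuantumFields.YangMills.BalabanUVNodes.N15KingModelRung.Covariant (covLapF fib fib_apply sum_norm_fib_sq norm_toEuclideanLin_of_mem_unitaryGroup)
open Summit.QuantumFields.YangMills.BalabanUVNodes.N15KingModelRung.Curvature (bondE bondE_nonneg toEuclideanLin_mul_apply)
open Summit.QuantumFields.YangMills.BalabanUVNodes.N15KingModelRung.Landau (eigenvalues_ge_of_coercive' posDef_of_coercive' l2_opNorm_inv_le_of_coercive')

variable {d : ℕ} {L : ℕ} [NeZero L] (T : BlockTree d L) (M : Fin (d + 1) → ℕ) [hM : ∀ μ, NeZero (M μ)]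
variable {𝕜 : Type*} [RCLike 𝕜] {n : Type*} [Fintype n] [DecidableEq n]

/-! ## §1 The contour bonds are flat in the tree gauge -/

omit hM in
/-- ★★ **TREE-GAUGE FLATNESS OF THE CONTOUR BONDS**: for the contour bond `(x⁻, μ) = (site y (parent j), axis j)` into `x_j = site y j` and a unitary `U`,
`‖v_{x⁻} − U(x⁻,μ)v_{x_j}‖² = ‖w_y(parent j) − w_y(j)‖²`, `w_y = blockTransport U v y` — after transport to the corner the covariant difference along a contour bond is a plain
difference. [cite: Balaban1984PropagatorsI, (1.7) p.18; Balaban1985BackgroundPropagators, (3.19) p.393, (3.23) p.394; Federbush1987PhaseCellIII, §5.3 p.303] -/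
theorem bondE_treeBond_eq {U : Tor (fine L M) × Fin (d + 1) → Matrix n n 𝕜} (hU : ∀ bd, U bd ∈ Matrix.unitaryGroup n 𝕜) (v : Tor (fine L M) × n → 𝕜) (y : Tor M)
    {j : Fin (d + 1) → Fin L} (hj : j ≠ T.root) :
    bondE (fine L M) U v (site L M y (T.parent j)) (T.axis j) = ‖blockTransport T M U v y (T.parent j) - blockTransport T M U v y j‖ ^ 2 := by
  rw [bondE, ← site_eq_parent_add_unitVec T M y hj]
  simp only [blockTransport]
  rw [treeHol_of_ne_root T M U y hj, toEuclideanLin_mul_apply, ← map_sub, norm_toEuclideanLin_of_mem_unitaryGroup (treeHol_mem_unitaryGroup T M hU y _)]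

/-- ★ THE CONTOUR BONDS ARE AMONG ALL BONDS: `Σ_yΣ_{j≠0} bondE(site y (parent j), axis j) ≤ Σ_xΣ_μ bondE(x,μ)` (distinct bonds, non-negative terms).
[cite: Balaban1984PropagatorsI, (1.7) p.18; Balaban1985BackgroundPropagators, (3.23) p.394] -/
theorem sum_treeBond_bondE_le (U : Tor (fine L M) × Fin (d + 1) → Matrix n n 𝕜) (v : Tor (fine L M) × n → 𝕜) :
    ∑ y : Tor M, ∑ j ∈ univ.filter (fun j => j ≠ T.root), bondE (fine L M) U v (site L M y (T.parent j)) (T.axis j) ≤ ∑ x, ∑ μ, bondE (fine L M) U v x μ := by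
  classical
  set s : Finset (Tor M × (Fin (d + 1) → Fin L)) := (univ : Finset (Tor M)) ×ˢ (univ.filter fun j => j ≠ T.root) with hs
  set tb : Tor M × (Fin (d + 1) → Fin L) → Tor (fine L M) × Fin (d + 1) := fun p => (site L M p.1 (T.parent p.2), T.axis p.2) with htb
  have hinj : ∀ p ∈ s, ∀ q ∈ s, tb p = tb q → p = q := by
    rintro ⟨y, j⟩ hyj ⟨y', j'⟩ hyj' h
    simp only [hs, Finset.mem_product, Finset.mem_filter, Finset.mem_univ, true_and] at hyj hyj'
    obtain ⟨h1, h2⟩ := treeBond_injective T M (b := y) (b' := y') hyj hyj' h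
    exact Prod.ext h1 h2
  calc ∑ y : Tor M, ∑ j ∈ univ.filter (fun j => j ≠ T.root), bondE (fine L M) U v (site L M y (T.parent j)) (T.axis j)
      = ∑ p ∈ s, bondE (fine L M) U v (tb p).1 (tb p).2 := by rw [hs, Finset.sum_product]
    _ = ∑ q ∈ s.image tb, bondE (fine L M) U v q.1 q.2 := by rw [Finset.sum_image hinj]
    _ ≤ ∑ q : Tor (fine L M) × Fin (d + 1), bondE (fine L M) U v q.1 q.2 :=
        Finset.sum_le_sum_of_subset_of_nonneg (Finset.subset_univ _) fun q _ _ => bondE_nonneg (fine L M) U v q.1 q.2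
    _ = ∑ x, ∑ μ, bondE (fine L M) U v x μ := Fintype.sum_prod_type _

/-! ## §2 The tree-gauge floor -/

/-- THE TREE FLOOR `γ_tree = min(a, c∕(L^{d+1}·D))` of the full operator for a tree contour system of depth `≤ D` (PART Ϥ-a's constant with `|V| = L^{d+1}` offsets per block).
[cite: Balaban1985BackgroundPropagators, p.395 l.1–3, (3.24) p.394] -/
def treeGap (a c : ℝ) (L d D : ℕ) : ℝ := min a (c / ((L : ℝ) ^ (d + 1) * D))

/-- ★★★ **UNIFORM POSITIVITY AT EVERY LINK FIELD (tree gauge)**: for every tree contour system of depth `≤ D`, every UNITARY link field `U` (any fibre `𝕜ⁿ`, abelian or not; no regularity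
assumed), `c ≥ 0` and every `a`, `m²`:  `(m² + min(a, c∕(L^{d+1}D)))·Σ_x‖v_x‖² ≤ Re⟨v, A₀(U)v⟩`.
[cite: Balaban1985BackgroundPropagators, p.395 l.1–3, (3.19) p.393, (3.24) p.394; King1986, (2.13) p.653; Balaban1984PropagatorsI, (1.7) p.18] -/
theorem re_quadForm_fullOpU_ge_tree {D : ℕ} (hD : ∀ j, T.depth j ≤ D) {c : ℝ} (hc : 0 ≤ c) (a m2 : ℝ) {U : Tor (fine L M) × Fin (d + 1) → Matrix n n 𝕜}
    (hU : ∀ bd, U bd ∈ Matrix.unitaryGroup n 𝕜) (v : Tor (fine L M) × n → 𝕜) :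
    (m2 + treeGap a c L d D) * ∑ x, ‖fib (fine L M) v x‖ ^ 2 ≤ RCLike.re (star v ⬝ᵥ (fullOpU T M a c m2 U *ᵥ v)) := by
  rw [re_quadForm_fullOpU T M a c m2 hU v, add_mul]
  have hcard : (Fintype.card (Fin (d + 1) → Fin L) : ℝ) = (L : ℝ) ^ (d + 1) := by
    rw [Fintype.card_fun, Fintype.card_fin, Fintype.card_fin]; push_cast; ring
  -- per block: the tree engine
  have hblock : ∀ y : Tor M, treeGap a c L d D * ∑ j, ‖blockTransport T M U v y j‖ ^ 2
      ≤ a * ((L : ℝ) ^ (d + 1) * ‖fib M (covQ T M U *ᵥ v) y‖ ^ 2)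
        + c * ∑ j ∈ univ.filter (fun j => j ≠ T.root), bondE (fine L M) U v (site L M y (T.parent j)) (T.axis j) := by
    intro y
    have h := tree_coercive T.toRootedTree (𝕜 := 𝕜) (a := a) hc hD (blockTransport T M U v y)
    rw [hcard, ← fib_covQ_mulVec T M U v y] at h
    have hbonds : ∑ j ∈ univ.filter (fun j => j ≠ T.root), ‖blockTransport T M U v y j - blockTransport T M U v y (T.parent j)‖ ^ 2
        = ∑ j ∈ univ.filter (fun j => j ≠ T.root), bondE (fine L M) U v (site L M y (T.parent j)) (T.axis j) := by
      refine Finset.sum_congr rfl fun j hj => ?_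
      rw [bondE_treeBond_eq T M hU v y (Finset.mem_filter.mp hj).2, norm_sub_rev]
    rw [hbonds] at h
    exact h
  have hsum := Finset.sum_le_sum fun y (_ : y ∈ (univ : Finset (Tor M))) => hblock y
  rw [← Finset.mul_sum, sum_norm_blockTransport_sq T M hU v, Finset.sum_add_distrib, ← Finset.mul_sum, ← Finset.mul_sum, ← Finset.mul_sum] at hsum
  have htree := sum_treeBond_bondE_le T M U v
  have hc' : c * ∑ y : Tor M, ∑ j ∈ univ.filter (fun j => j ≠ T.root), bondE (fine L M) U v (site L M y (T.parent j)) (T.axis j) ≤ c * ∑ x, ∑ μ, bondE (fine L M) U v x μ :=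
    mul_le_mul_of_nonneg_left htree hc
  nlinarith [hsum, hc']

/-- ★★★ **THE COMB FLOOR**: with the comb contours (PART Ϥ-b `kingComb`, depth `≤ (d+1)(L−1)`): `(m² + min(a, c∕(L^{d+1}(d+1)(L−1))))·Σ_x‖v_x‖² ≤ Re⟨v, A₀(U)v⟩` for EVERY unitary `U`
— order `c·((d+1)L^{d+2})⁻¹`; in King's units (`c = η⁻² = L²`, unit blocks) the comb floor is `min(a, ((d+1)(L−1)L^{d−1})⁻¹) ≍ η^d∕(d+1)`.
[cite: Balaban1985BackgroundPropagators, p.395 l.1–3; King1986, (2.12)–(2.13) p.653; Balaban1984PropagatorsI, (1.7) p.18] -/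
theorem re_quadForm_fullOpU_kingComb_ge {c : ℝ} (hc : 0 ≤ c) (a m2 : ℝ) {U : Tor (fine L M) × Fin (d + 1) → Matrix n n 𝕜} (hU : ∀ bd, U bd ∈ Matrix.unitaryGroup n 𝕜)
    (v : Tor (fine L M) × n → 𝕜) :
    (m2 + treeGap a c L d ((d + 1) * (L - 1))) * ∑ x, ‖fib (fine L M) v x‖ ^ 2 ≤ RCLike.re (star v ⬝ᵥ (fullOpU (kingComb d L) M a c m2 U *ᵥ v)) :=
  re_quadForm_fullOpU_ge_tree (kingComb d L) M (kingComb_depth_le) hc a m2 hU v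

/-! ## §3 The massless full propagator exists at every `U`, uniformly -/

/-- The tree floor is positive for `a, c > 0` and `D ≥ 1`. [folklore] -/
theorem treeGap_pos {a c : ℝ} (ha : 0 < a) (hc : 0 < c) {D : ℕ} (hD : 0 < D) (d : ℕ) : 0 < treeGap a c L d D := by
  unfold treeGap
  have hL : (0 : ℝ) < (L : ℝ) ^ (d + 1) := pow_pos (by exact_mod_cast Nat.pos_of_ne_zero (NeZero.ne L)) _
  have hD' : (0 : ℝ) < D := by exact_mod_cast hD
  exact lt_min ha (div_pos hc (mul_pos hL hD'))

/-- ★★ EVERY EIGENVALUE of `A₀(U)` is `≥ m² + γ_tree`, for every unitary `U`. [cite: Balaban1985BackgroundPropagators, p.395 l.1–3; HornJohnson2013, Thm 4.2.2] -/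
theorem eigenvalues_fullOpU_ge_tree {D : ℕ} (hD : ∀ j, T.depth j ≤ D) {c : ℝ} (hc : 0 ≤ c) (a m2 : ℝ) {U : Tor (fine L M) × Fin (d + 1) → Matrix n n 𝕜}
    (hU : ∀ bd, U bd ∈ Matrix.unitaryGroup n 𝕜) (i : Tor (fine L M) × n) :
    m2 + treeGap a c L d D ≤ (isHermitian_fullOpU T M a c m2 U).eigenvalues i :=
  eigenvalues_ge_of_coercive' (fine L M) (isHermitian_fullOpU T M a c m2 U) (re_quadForm_fullOpU_ge_tree T M hD hc a m2 hU) i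

/-- ★★★ **THE MASSLESS FULL OPERATOR `−cΔ_U + aQ(U)^*Q(U)` IS POSITIVE DEFINITE AT EVERY UNITARY LINK FIELD** (`a, c > 0`, a tree contour system of positive depth bound `D`): the
block term removes every zero mode at every `U` — not only at `U ≡ 1` (King), where the massless fine operator alone is singular (Ͱ-f `not_posDef_covLapF_massless_free`).
[cite: Balaban1985BackgroundPropagators, p.395 l.1–3, (3.24)–(3.27) p.394–395; King1986, (2.13) p.653] -/
theorem posDef_fullOpU_massless {D : ℕ} (hD : ∀ j, T.depth j ≤ D) (hD0 : 0 < D) {a c : ℝ} (ha : 0 < a) (hc : 0 < c) {U : Tor (fine L M) × Fin (d + 1) → Matrix n n 𝕜}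
    (hU : ∀ bd, U bd ∈ Matrix.unitaryGroup n 𝕜) : (fullOpU T M a c 0 U).PosDef :=
  posDef_of_coercive' (fine L M) (isHermitian_fullOpU T M a c 0 U) (κ := 0 + treeGap a c L d D) (by rw [zero_add]; exact treeGap_pos ha hc hD0 d)
    (re_quadForm_fullOpU_ge_tree T M hD hc.le a 0 hU)

/-- The massless full operator is invertible at every unitary `U`: the full propagator `G(U) = A₀(U)⁻¹` exists. [cite: Balaban1985BackgroundPropagators, (3.27) p.395] -/
theorem isUnit_fullOpU_massless {D : ℕ} (hD : ∀ j, T.depth j ≤ D) (hD0 : 0 < D) {a c : ℝ} (ha : 0 < a) (hc : 0 < c) {U : Tor (fine L M) × Fin (d + 1) → Matrix n n 𝕜}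
    (hU : ∀ bd, U bd ∈ Matrix.unitaryGroup n 𝕜) : IsUnit (fullOpU T M a c 0 U) :=
  (posDef_fullOpU_massless T M hD hD0 ha hc hU).isUnit

/-- ★★★ **`U`-UNIFORM BOUND ON THE MASSLESS FULL PROPAGATOR**: `‖(−cΔ_U + aQ(U)^*Q(U))⁻¹‖_{ℓ²→ℓ²} ≤ min(a, c∕(L^{d+1}D))⁻¹` for EVERY unitary `U` — one constant for all link fields and all
volumes `M`. [cite: Balaban1985BackgroundPropagators, p.395 l.1–3, (3.39) p.397; King1986, (2.13) p.653] -/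
theorem l2_opNorm_fullOpU_massless_inv_le {D : ℕ} (hD : ∀ j, T.depth j ≤ D) (hD0 : 0 < D) {a c : ℝ} (ha : 0 < a) (hc : 0 < c) {U : Tor (fine L M) × Fin (d + 1) → Matrix n n 𝕜}
    (hU : ∀ bd, U bd ∈ Matrix.unitaryGroup n 𝕜) : ‖(fullOpU T M a c 0 U)⁻¹‖ ≤ (treeGap a c L d D)⁻¹ := by
  have h := l2_opNorm_inv_le_of_coercive' (fine L M) (isHermitian_fullOpU T M a c 0 U) (κ := 0 + treeGap a c L d D) (by rw [zero_add]; exact treeGap_pos ha hc hD0 d)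
    (re_quadForm_fullOpU_ge_tree T M hD hc.le a 0 hU)
  rwa [zero_add] at h

/-- ★★ **ONE CONSTANT FOR ALL LINK FIELDS** (comb contours, `L ≥ 2`, `a, c > 0`): `∃ γ > 0` (namely `min(a, c∕(L^{d+1}(d+1)(L−1)))`) such that for EVERY unitary `U` on the torus the massless
full operator satisfies `γΣ‖v_x‖² ≤ Re⟨v,(−cΔ_U + aQ(U)^*Q(U))v⟩`, is positive definite, and `‖G(U)‖ ≤ γ⁻¹`. [cite: Balaban1985BackgroundPropagators, p.395 l.1–3; King1986, (2.13) p.653] -/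
theorem king_full_propagator_uniform_in_U (hL : 2 ≤ L) {a c : ℝ} (ha : 0 < a) (hc : 0 < c) :
    ∃ γ : ℝ, 0 < γ ∧ ∀ U : Tor (fine L M) × Fin (d + 1) → Matrix n n 𝕜, (∀ bd, U bd ∈ Matrix.unitaryGroup n 𝕜) →
      (∀ v : Tor (fine L M) × n → 𝕜, γ * ∑ x, ‖fib (fine L M) v x‖ ^ 2 ≤ RCLike.re (star v ⬝ᵥ (fullOpU (kingComb d L) M a c 0 U *ᵥ v)))
        ∧ (fullOpU (kingComb d L) M a c 0 U).PosDef ∧ ‖(fullOpU (kingComb d L) M a c 0 U)⁻¹‖ ≤ γ⁻¹ := by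
  have hD0 : 0 < (d + 1) * (L - 1) := Nat.mul_pos (Nat.succ_pos d) (by omega)
  refine ⟨treeGap a c L d ((d + 1) * (L - 1)), treeGap_pos ha hc hD0 d, fun U hU => ⟨fun v => ?_, ?_, ?_⟩⟩
  · have h := re_quadForm_fullOpU_kingComb_ge M hc.le a 0 hU v; rwa [zero_add] at h
  · exact posDef_fullOpU_massless (kingComb d L) M kingComb_depth_le hD0 ha hc hU
  · exact l2_opNorm_fullOpU_massless_inv_le (kingComb d L) M kingComb_depth_le hD0 ha hc hU

end Summit.QuantumFields.YangMills.BalabanUVNodes.N15KingModelRung.CovariantBlock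

end
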